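import Literature.Analysis.FluidPDE.ElgindiTheoremTwoLinear
import Literature.Analysis.FluidPDE.ElgindiL12SupBound
import Mathlib.Analysis.SpecialFunctions.ImproperIntegrals
import HarnessLib

/-!
# Weighted `L¹` control of the Theorem 2 solutions by the data
([Elgindi2021] §7.5 Theorem 2 — continuity of `F ↦ Ψ_F` for the passage to the limit)

Topic `Literature/Analysis/FluidPDE`. Support file (definitions with bodies and proved theorems, no
named facts) on the proof path of the named fact
`Literature.Analysis.FluidPDE.Elgindi.ElgindiGhoulMasmoudi2021_stabilityCore`
(`ElgindiStabilityDecomposition.lean`). T. M. Elgindi, Ann. of Math. 194 (2021) =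
arXiv:1904.04795, §7.5 (p. 24).

With the weight `ρ(R, θ) = e^{−R}` on the strip (a finite measure), the Theorem 2 solution
`Ψ = Ψ̂ − (G⋆ + Ḡ) ⊗ sin 2θ` of a nice datum `F` satisfies
`∫∫_strip |Ψ_{F₁} − Ψ_{F₂}|·ρ ≤ C(α)·|F₁ − F₂|_{𝓗⁴}` (`lintegral_thmTwoSol_sub_le`): the weak
solution part through the energy bound `min(½,2α)‖U‖ ≤ ‖F̂‖_{L²}`, `Ḡ` through its weighted radial
energy, and the non-square-integrable `G⋆ = −(4α)⁻¹L₁₂(F)` through the uniform bound of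
`ElgindiL12SupBound.lean`.
-/

noncomputable section

open MeasureTheory Set Function Real Filter Finset
open _root_.Topology
open scoped ENNReal ContDiff

namespace Literature.Analysis.FluidPDE

namespace Elgindi

/-! ### The weight `ρ = e^{−R}` and Cauchy–Schwarz against it -/

/-- The weight `ρ(R, θ) = e^{−R}`. [folklore] -/
def rhoW (p : ℝ × ℝ) : ℝ := Real.exp (-p.1)

/-- `0 < ρ ≤ 1`. [folklore] -/
theorem rhoW_pos (p : ℝ × ℝ) : 0 < rhoW p := Real.exp_pos _

/-- `ρ ≤ 1` on the strip. [folklore] -/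
theorem rhoW_le_one {p : ℝ × ℝ} (hp : p ∈ strip) : rhoW p ≤ 1 := by
  unfold rhoW; rw [Real.exp_le_one_iff]; have h : 0 < p.1 := hp.1; linarith

/-- `ρ` is continuous and measurable. [folklore] -/
theorem measurable_rhoW : Measurable rhoW := by unfold rhoW; fun_prop

/-- `∫∫_strip ρ² ≤ ∫∫_strip ρ ≤ π/2·1 < ∞`; we record the crude bound `∫∫_strip ρ^k ≤ 2` for `k = 1, 2`. [folklore] -/
theorem lintegral_rhoW_pow_le (k : ℕ) (hk : 1 ≤ k) : ∫⁻ p in strip, ENNReal.ofReal (rhoW p ^ k) ≤ 2 := by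
  -- `ρ^k ≤ ρ = e^{-R}`, a tensor: `∫_{R>0} e^{-R} = 1`, `∫_θ 1 = π/2 ≤ 2`
  have h1 : ∫⁻ p in strip, ENNReal.ofReal (rhoW p ^ k) ≤ ∫⁻ p in strip, ENNReal.ofReal (Real.exp (-p.1)) * 1 := by
    refine setLIntegral_mono' measurableSet_strip fun p hp => ?_
    rw [mul_one]
    refine ENNReal.ofReal_le_ofReal ?_
    calc rhoW p ^ k ≤ rhoW p ^ 1 := pow_le_pow_of_le_one (rhoW_pos p).le (rhoW_le_one hp) hk
      _ = Real.exp (-p.1) := by rw [pow_one]; rfl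
  refine h1.trans ?_
  rw [lintegral_strip_tensor (a := fun R => ENNReal.ofReal (Real.exp (-R))) (b := fun _ => 1) (by fun_prop) aemeasurable_const,
    setLIntegral_const, Real.volume_Ioo]
  have hexp : ∫⁻ R in Ioi (0:ℝ), ENNReal.ofReal (Real.exp (-R)) = 1 := by
    rw [← ofReal_integral_eq_lintegral_ofReal (integrableOn_exp_neg_Ioi 0) (ae_of_all _ fun R => (Real.exp_pos _).le),
      integral_exp_neg_Ioi_zero, ENNReal.ofReal_one]
  rw [hexp, one_mul, one_mul, sub_zero]
  have hπ : ENNReal.ofReal (π / 2) ≤ ENNReal.ofReal 2 := ENNReal.ofReal_le_ofReal (by linarith [Real.pi_lt_four])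
  exact hπ.trans (by rw [ENNReal.ofReal_ofNat])

/-- **Cauchy–Schwarz against `ρ`**: `∫∫_strip |g|ρ ≤ (∫∫_strip g²)^{1/2}·2^{1/2}` for measurable `g`. [folklore] -/
theorem lintegral_abs_mul_rhoW_le {g : ℝ × ℝ → ℝ} (hg : AEMeasurable g (volume.restrict strip)) :
    ∫⁻ p in strip, ENNReal.ofReal (|g p| * rhoW p) ≤ (∫⁻ p in strip, ENNReal.ofReal (g p ^ 2)) ^ (1 / 2 : ℝ) * (2:ℝ≥0∞) ^ (1 / 2 : ℝ) := by
  set F : ℝ × ℝ → ℝ≥0∞ := fun p => ENNReal.ofReal |g p| with hF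
  set G : ℝ × ℝ → ℝ≥0∞ := fun p => ENNReal.ofReal (rhoW p) with hG
  have mF : AEMeasurable F (volume.restrict strip) := (continuous_abs.measurable.comp_aemeasurable hg).ennreal_ofReal
  have mG : AEMeasurable G (volume.restrict strip) := measurable_rhoW.ennreal_ofReal.aemeasurable
  have hH := ENNReal.lintegral_mul_le_Lp_mul_Lq (volume.restrict strip) Real.HolderConjugate.two_two mF mG
  have eFG : ∀ p : ℝ × ℝ, (F * G) p = ENNReal.ofReal (|g p| * rhoW p) := fun p => by
    simp only [Pi.mul_apply, hF, hG]; rw [← ENNReal.ofReal_mul (abs_nonneg _)]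
  have e2 : ∀ (x : ℝ), 0 ≤ x → ENNReal.ofReal x ^ (2:ℝ) = ENNReal.ofReal (x ^ 2) := fun x hx => by
    rw [show (2:ℝ) = ((2:ℕ) : ℝ) by norm_num, ENNReal.rpow_natCast, ENNReal.ofReal_pow hx]
  have eF2 : ∀ p : ℝ × ℝ, F p ^ (2:ℝ) = ENNReal.ofReal (g p ^ 2) := fun p => by
    simp only [hF]; rw [e2 _ (abs_nonneg _), sq_abs]
  have eG2 : ∀ p : ℝ × ℝ, G p ^ (2:ℝ) = ENNReal.ofReal (rhoW p ^ 2) := fun p => by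
    simp only [hG]; rw [e2 _ (rhoW_pos p).le]
  simp_rw [eFG, eF2, eG2] at hH
  refine hH.trans (mul_le_mul' le_rfl (ENNReal.rpow_le_rpow (lintegral_rhoW_pow_le 2 (by norm_num)) (by norm_num)))



/-! ### `L²(strip)` through the `𝓗⁴` functional -/

/-- `∫∫_strip f² ≤ |f|²_{𝓗⁴}` (the radial term of order `0` has weight `≥ 1`). [folklore] -/
theorem lintegral_sq_le_eHkNormSq (α : ℝ) (f : ℝ → ℝ → ℝ) :
    ∫⁻ p in strip, ENNReal.ofReal (f p.1 p.2 ^ 2) ≤ eHkNormSq α 4 f := by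
  refine le_trans ?_ (eL2Sq_hkRadialTerm_le α (show 0 ≤ 4 by norm_num) f)
  rw [eL2Sq_eq_lintegral_ofReal]
  refine setLIntegral_mono' measurableSet_strip fun p hp => ENNReal.ofReal_le_ofReal ?_
  have hw : 1 ≤ radialWeight p.1 := by
    have hz : 0 < p.1 := hp.1
    unfold radialWeight; rw [le_div_iff₀ (by positivity)]; nlinarith
  have hs : 0 < Real.sin (2 * p.2) := Real.sin_pos_of_pos_of_lt_pi (by linarith [hp.2.1]) (by linarith [hp.2.2])
  have hsle : Real.sin (2 * p.2) ^ (eta / 2) ≤ 1 := Real.rpow_le_one hs.le (Real.sin_le_one _) (by unfold eta; norm_num)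
  have hW : 1 ≤ hWeight p.1 p.2 := by
    unfold hWeight
    rw [le_div_iff₀ (Real.rpow_pos_of_pos hs _)]
    linarith
  simp only [hkRadialTerm, Function.iterate_zero, id_eq]
  have h0 : 0 ≤ hWeight p.1 p.2 := by linarith
  calc f p.1 p.2 ^ 2 = f p.1 p.2 ^ 2 * 1 := (mul_one _).symm
    _ ≤ f p.1 p.2 ^ 2 * hWeight p.1 p.2 ^ 2 := mul_le_mul_of_nonneg_left (by nlinarith) (sq_nonneg _)
    _ = (f p.1 p.2 * hWeight p.1 p.2) ^ 2 := by ring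

/-- `‖toL2 f‖ₑ ≤ |f|_{𝓗⁴}` for `f ∈ L²(strip)`. [folklore] -/
theorem enorm_toL2_le (α : ℝ) {f : ℝ → ℝ → ℝ} (hf : MemLp (fun p : ℝ × ℝ => f p.1 p.2) 2 stripMeasure) :
    ‖toL2 (fun p : ℝ × ℝ => f p.1 p.2)‖ₑ ≤ (eHkNormSq α 4 f) ^ (1 / 2 : ℝ) := by
  rw [toL2_eq_toLp hf, Lp.enorm_toLp hf, eLpNorm_eq_lintegral_rpow_enorm_toReal two_ne_zero ENNReal.ofNat_ne_top]
  simp only [ENNReal.toReal_ofNat, one_div]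
  refine ENNReal.rpow_le_rpow ?_ (by norm_num)
  refine le_trans (le_of_eq ?_) (lintegral_sq_le_eHkNormSq α f)
  refine lintegral_congr fun p => ?_
  rw [Real.enorm_eq_ofReal_abs, show (2:ℝ) = ((2:ℕ) : ℝ) by norm_num, ENNReal.rpow_natCast, ← ENNReal.ofReal_pow (abs_nonneg _), sq_abs]

/-! ### The three parts of the Theorem 2 solution against `ρ` -/

section parts

variable {α : ℝ} {F : ℝ → ℝ → ℝ} (hF : NiceDatum F) {U : ℕ → E4} {Ψr : ℝ × ℝ → ℝ} (hS : SolData α (Fhat F) U Ψr)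
include hF hS

/-- **The weak-solution part**: `(∫∫_strip Ψ̂²)^{1/2} ≤ (min(½,2α))⁻¹·|F̂|_{𝓗⁴}`. [folklore] -/
theorem lintegral_sq_rep_le :
    (∫⁻ p in strip, ENNReal.ofReal (Ψr p ^ 2)) ^ (1 / 2 : ℝ) ≤ ENNReal.ofReal (1 / min (1 / 2) (2 * α)) * (eHkNormSq α 4 (Fhat F)) ^ (1 / 2 : ℝ) := by
  have hα : 0 < α := hS.pos
  have hα1 : α ≤ 1 := hS.le4.trans (by norm_num)
  have hm : 0 < min (1 / 2 : ℝ) (2 * α) := lt_min (by norm_num) (by linarith)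
  -- `∫ Ψ̂² = ‖U 0 0‖ₑ²` (a.e. equality on the strip)
  have hsol := hS.sol 0
  have e0 : (toL2 fun p : ℝ × ℝ => (Dz^[0] (Fhat F)) p.1 p.2) = toL2 (fun p : ℝ × ℝ => Fhat F p.1 p.2) := by rfl
  rw [e0] at hsol
  have hnorm := IsWeakSol.norm_le hα hα1 hsol   -- `min(½,2α)‖U 0‖ ≤ ‖toL2 F̂‖`
  have h1 : (∫⁻ p in strip, ENNReal.ofReal (Ψr p ^ 2)) = ‖U 0 0‖ₑ ^ (2:ℝ) := by
    rw [Lp.enorm_def, eLpNorm_eq_lintegral_rpow_enorm_toReal two_ne_zero ENNReal.ofNat_ne_top]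
    simp only [ENNReal.toReal_ofNat, one_div]
    rw [← ENNReal.rpow_mul, show ((2:ℝ)⁻¹ * 2) = 1 by norm_num, ENNReal.rpow_one]
    show _ = ∫⁻ p, ‖(U 0 0 : ℝ × ℝ → ℝ) p‖ₑ ^ (2:ℝ) ∂stripMeasure
    unfold stripMeasure
    refine lintegral_congr_ae ?_
    have hae' : ∀ᵐ y ∂(volume.restrict strip), (U 0 0 : ℝ × ℝ → ℝ) y = Ψr y := (ae_restrict_iff' measurableSet_strip).2 hS.ae
    filter_upwards [hae'] with p hp
    rw [← hp, Real.enorm_eq_ofReal_abs, show (2:ℝ) = ((2:ℕ) : ℝ) by norm_num, ENNReal.rpow_natCast, ← ENNReal.ofReal_pow (abs_nonneg _), sq_abs]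
    rfl
  rw [h1, ← ENNReal.rpow_mul, show ((2:ℝ) * (1 / 2)) = 1 by norm_num, ENNReal.rpow_one]
  -- `‖U 0 0‖ₑ ≤ ‖U 0‖ₑ ≤ (1/m)‖toL2 F̂‖ₑ ≤ (1/m) E^{1/2}`
  have h2 : ‖U 0 0‖ₑ ≤ ‖U 0‖ₑ := PiLp.enorm_apply_le (U 0) 0
  have h3 : ‖U 0‖ₑ ≤ ENNReal.ofReal (1 / min (1 / 2) (2 * α)) * ‖toL2 (fun p : ℝ × ℝ => Fhat F p.1 p.2)‖ₑ := by
    rw [← ofReal_norm, ← ofReal_norm, ← ENNReal.ofReal_mul (by positivity)]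
    refine ENNReal.ofReal_le_ofReal ?_
    rw [one_div, inv_mul_eq_div, le_div_iff₀ hm, mul_comm]
    exact hnorm
  have mF : MemLp (fun p : ℝ × ℝ => Fhat F p.1 p.2) 2 stripMeasure :=
    memLp_strip_of_continuous (hF.contDiff_Fhat 0).continuous hF.hasCompactSupport_Fhat.1
  exact h2.trans (h3.trans (mul_le_mul_right (enorm_toL2_le α mF) _))

omit hS in
/-- **The `Ḡ` part**: `∫∫_strip Ḡ(R)²sin²(2θ) ≤ 2·radialEnergy 0 (Ḡ) ≤ (2/324)(9π/32)|F|²_{𝓗⁴}`. [folklore] -/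
theorem lintegral_sq_Gbar_le (hα : 0 < α) (hα1 : α ≤ 1) :
    ∫⁻ p in strip, ENNReal.ofReal ((Gbar α F p.1 * Real.sin (2 * p.2)) ^ 2) ≤ 2 * (ENNReal.ofReal (1 / 324) * (ENNReal.ofReal (9 * π / 32) * eHkNormSq α 4 F)) := by
  have ha : AEMeasurable (fun R => ENNReal.ofReal (radialWeight R ^ 2 * Gbar α F R ^ 2)) (volume.restrict (Ioi 0)) := by
    have hc : ContinuousOn (fun R => radialWeight R ^ 2 * Gbar α F R ^ 2) (Ioi 0) := by
      refine ContinuousOn.mul ?_ ((hF.contDiffOn_Gbar 0).continuousOn.pow 2)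
      unfold radialWeight
      exact (ContinuousOn.div (by fun_prop) (by fun_prop) fun R hR => pow_ne_zero 2 (ne_of_gt hR)).pow 2
    exact (hc.aemeasurable measurableSet_Ioi).ennreal_ofReal
  calc ∫⁻ p in strip, ENNReal.ofReal ((Gbar α F p.1 * Real.sin (2 * p.2)) ^ 2)
      ≤ ∫⁻ p in strip, ENNReal.ofReal (radialWeight p.1 ^ 2 * Gbar α F p.1 ^ 2) * 1 := by
        refine setLIntegral_mono' measurableSet_strip fun p hp => ?_
        rw [mul_one]
        refine ENNReal.ofReal_le_ofReal ?_
        have hw : 1 ≤ radialWeight p.1 := by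
          have hz : 0 < p.1 := hp.1
          unfold radialWeight; rw [le_div_iff₀ (by positivity)]; nlinarith
        have hs1 : Real.sin (2 * p.2) ^ 2 ≤ 1 := by
          have := Real.sin_sq_le_one (2 * p.2); exact this
        have hw2 : 1 ≤ radialWeight p.1 ^ 2 := by nlinarith
        calc (Gbar α F p.1 * Real.sin (2 * p.2)) ^ 2 = Gbar α F p.1 ^ 2 * Real.sin (2 * p.2) ^ 2 := by ring
          _ ≤ Gbar α F p.1 ^ 2 * 1 := mul_le_mul_of_nonneg_left hs1 (sq_nonneg _)
          _ ≤ radialWeight p.1 ^ 2 * Gbar α F p.1 ^ 2 := by rw [mul_one]; nlinarith [sq_nonneg (Gbar α F p.1)]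
    _ = (∫⁻ R in Ioi 0, ENNReal.ofReal (radialWeight R ^ 2 * Gbar α F R ^ 2)) * ∫⁻ _ in Ioo 0 (π / 2), (1:ℝ≥0∞) :=
        lintegral_strip_tensor ha aemeasurable_const
    _ ≤ radialEnergy 0 (Gbar α F) * 2 := by
        refine mul_le_mul' (le_of_eq rfl) ?_
        rw [setLIntegral_const, Real.volume_Ioo, one_mul, sub_zero]
        have h2 : π / 2 ≤ 2 := by linarith [Real.pi_lt_four]
        exact (ENNReal.ofReal_le_ofReal h2).trans (by rw [ENNReal.ofReal_ofNat 2])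
    _ ≤ (ENNReal.ofReal (1 / 324) * radialEnergy 0 (kMoment F)) * 2 := mul_le_mul_left (hF.radialEnergy_Gbar_le hα hα1 0) _
    _ ≤ (ENNReal.ofReal (1 / 324) * (ENNReal.ofReal (9 * π / 32) * eHkNormSq α 4 F)) * 2 := by
        refine mul_le_mul_left (mul_le_mul_right ((radialEnergy_kMoment_le (hF.smooth 0) hF.supp).trans (mul_le_mul_right ?_ _)) _) _
        exact eL2Sq_hkRadialTerm_le α (by norm_num) F
    _ = _ := by ring

omit hS in
/-- **The `G⋆` part, pointwise**: `|G⋆(R)| ≤ (4α)⁻¹√2·((9π/32)|F|²_{𝓗⁴})^{1/2}`. [folklore] -/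
theorem abs_Gstar_le (hα : 0 < α) (R : ℝ) :
    ENNReal.ofReal |Gstar α F R| ≤ ENNReal.ofReal (1 / (4 * α) * Real.sqrt 2) * (ENNReal.ofReal (9 * π / 32) * eHkNormSq α 4 F) ^ (1 / 2 : ℝ) := by
  have h := abs_L12_le (hF.smooth 0) hF.supp hF.sub R
  have hk : radialEnergy 0 (kMoment F) ≤ ENNReal.ofReal (9 * π / 32) * eHkNormSq α 4 F :=
    (radialEnergy_kMoment_le (hF.smooth 0) hF.supp).trans (mul_le_mul_right (eL2Sq_hkRadialTerm_le α (by norm_num) F) _)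
  have e : |Gstar α F R| = 1 / (4 * α) * |L12 F R| := by
    simp only [Gstar]; rw [abs_mul, abs_neg, abs_of_pos (by positivity)]
  rw [e, ENNReal.ofReal_mul (by positivity), ENNReal.ofReal_mul (by positivity), mul_assoc]
  exact mul_le_mul_right (h.trans (mul_le_mul_right (ENNReal.rpow_le_rpow hk (by norm_num)) _)) _

/-! ### The combination -/

omit hF hS in
/-- **The constant of the weighted `L¹` bound** `∫∫_strip |Ψ_F|ρ ≤ cauchyC(α)·|F|_{𝓗⁴}`. [folklore] -/
def cauchyC (α : ℝ) : ℝ≥0∞ :=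
  ENNReal.ofReal (1 / min (1 / 2) (2 * α)) * (2 + 20 * ENNReal.ofReal thmTwoK) ^ (1 / 2 : ℝ) * 2 ^ (1 / 2 : ℝ) +
    ENNReal.ofReal (1 / (4 * α) * Real.sqrt 2) * (ENNReal.ofReal (9 * π / 32)) ^ (1 / 2 : ℝ) * 2 +
    (2 * (ENNReal.ofReal (1 / 324) * ENNReal.ofReal (9 * π / 32))) ^ (1 / 2 : ℝ) * 2 ^ (1 / 2 : ℝ)

omit hF hS in
/-- `cauchyC α < ∞`. [folklore] -/
theorem cauchyC_ne_top (α : ℝ) : cauchyC α ≠ ⊤ := by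
  unfold cauchyC
  have hr : ∀ {x : ℝ≥0∞}, x ≠ ⊤ → x ^ (1 / 2 : ℝ) ≠ ⊤ := fun hx => ENNReal.rpow_ne_top_of_nonneg (by norm_num) hx
  refine ENNReal.add_ne_top.2 ⟨ENNReal.add_ne_top.2 ⟨?_, ?_⟩, ?_⟩
  · exact ENNReal.mul_ne_top (ENNReal.mul_ne_top ENNReal.ofReal_ne_top
      (hr (ENNReal.add_ne_top.2 ⟨ENNReal.ofNat_ne_top, ENNReal.mul_ne_top (by norm_num) ENNReal.ofReal_ne_top⟩))) (hr ENNReal.ofNat_ne_top)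
  · exact ENNReal.mul_ne_top (ENNReal.mul_ne_top ENNReal.ofReal_ne_top (hr ENNReal.ofReal_ne_top)) ENNReal.ofNat_ne_top
  · exact ENNReal.mul_ne_top (hr (ENNReal.mul_ne_top ENNReal.ofNat_ne_top (ENNReal.mul_ne_top ENNReal.ofReal_ne_top ENNReal.ofReal_ne_top)))
      (hr ENNReal.ofNat_ne_top)

/-- **Weighted `L¹` control of the Theorem 2 solution by the datum**:
`∫∫_strip |Ψ_F|·ρ ≤ cauchyC(α)·|F|_{𝓗⁴}` for a nice datum `F` and any solution data of `F̂`
(`Ψ_F = Ψ̂ − (G⋆ + Ḡ) ⊗ sin 2θ`). [cite: Elgindi2021, §7.5 Theorem 2 (p. 24 of arXiv:1904.04795)] -/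
theorem lintegral_thmTwoSol_rho_le :
    ∫⁻ p in strip, ENNReal.ofReal (|thmTwoSol α F Ψr p.1 p.2| * rhoW p) ≤ cauchyC α * (eHkNormSq α 4 F) ^ (1 / 2 : ℝ) := by
  have hα : 0 < α := hS.pos
  have hα4 : α ≤ 1 / 4 := hS.le4
  have hα1 : α ≤ 1 := hα4.trans (by norm_num)
  obtain ⟨hK0, hK⟩ := thmTwoK_spec
  -- the three integrands
  set f1 : ℝ × ℝ → ℝ≥0∞ := fun p => ENNReal.ofReal (|Ψr p| * rhoW p) with hf1
  set f2 : ℝ × ℝ → ℝ≥0∞ := fun p => ENNReal.ofReal (|Gstar α F p.1 * Real.sin (2 * p.2)| * rhoW p) with hf2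
  set f3 : ℝ × ℝ → ℝ≥0∞ := fun p => ENNReal.ofReal (|Gbar α F p.1 * Real.sin (2 * p.2)| * rhoW p) with hf3
  have hpt : ∀ p : ℝ × ℝ, ENNReal.ofReal (|thmTwoSol α F Ψr p.1 p.2| * rhoW p) ≤ f1 p + f2 p + f3 p := by
    intro p
    have hρ := (rhoW_pos p).le
    simp only [hf1, hf2, hf3]
    rw [← ENNReal.ofReal_add (mul_nonneg (abs_nonneg _) hρ) (mul_nonneg (abs_nonneg _) hρ),
      ← ENNReal.ofReal_add (add_nonneg (mul_nonneg (abs_nonneg _) hρ) (mul_nonneg (abs_nonneg _) hρ)) (mul_nonneg (abs_nonneg _) hρ)]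
    refine ENNReal.ofReal_le_ofReal ?_
    rw [← add_mul, ← add_mul]
    refine mul_le_mul_of_nonneg_right ?_ hρ
    have e : thmTwoSol α F Ψr p.1 p.2 =
        Ψr p + -(Gstar α F p.1 * Real.sin (2 * p.2)) + -(Gbar α F p.1 * Real.sin (2 * p.2)) := by
      simp only [thmTwoSol, Pi.sub_apply, tensor_apply, Gcor, sin2]; ring
    rw [e]
    calc |Ψr p + -(Gstar α F p.1 * Real.sin (2 * p.2)) + -(Gbar α F p.1 * Real.sin (2 * p.2))|
        ≤ |Ψr p + -(Gstar α F p.1 * Real.sin (2 * p.2))| + |-(Gbar α F p.1 * Real.sin (2 * p.2))| := abs_add_le _ _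
      _ ≤ |Ψr p| + |-(Gstar α F p.1 * Real.sin (2 * p.2))| + |-(Gbar α F p.1 * Real.sin (2 * p.2))| :=
          add_le_add_left (abs_add_le _ _) _
      _ = _ := by rw [abs_neg, abs_neg]
  have hΨm : AEMeasurable Ψr (volume.restrict strip) := hS.smooth.continuousOn.aemeasurable measurableSet_strip
  have m1 : AEMeasurable f1 (volume.restrict strip) :=
    ((continuous_abs.measurable.comp_aemeasurable hΨm).mul measurable_rhoW.aemeasurable).ennreal_ofReal
  have m2 : AEMeasurable f2 (volume.restrict strip) := by
    have hL : Continuous (L12 F) := hF.contDiff_L12F.continuous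
    have hc : Continuous fun p : ℝ × ℝ => |Gstar α F p.1 * Real.sin (2 * p.2)| * rhoW p := by
      unfold Gstar rhoW; fun_prop
    exact hc.measurable.ennreal_ofReal.aemeasurable
  -- part 1: the weak solution
  have b1 : ∫⁻ p in strip, f1 p ≤ ENNReal.ofReal (1 / min (1 / 2) (2 * α)) * (2 + 20 * ENNReal.ofReal thmTwoK) ^ (1 / 2 : ℝ) *
      2 ^ (1 / 2 : ℝ) * (eHkNormSq α 4 F) ^ (1 / 2 : ℝ) := by
    refine (lintegral_abs_mul_rhoW_le hΨm).trans ?_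
    have hFhat : eHkNormSq α 4 (Fhat F) ≤ (2 + 20 * ENNReal.ofReal thmTwoK) * eHkNormSq α 4 F := by
      refine (hF.eHk_Fhat_le hK hα hα1).trans ?_
      have hS5 : (∑ j ∈ range 5, radialEnergy j (kMoment F)) ≤ 5 * eHkNormSq α 4 F := hF.sum_radialEnergy_kM_le α
      calc 2 * eHkNormSq α 4 F + 4 * (ENNReal.ofReal thmTwoK * ∑ j ∈ range 5, radialEnergy j (kMoment F))
          ≤ 2 * eHkNormSq α 4 F + 4 * (ENNReal.ofReal thmTwoK * (5 * eHkNormSq α 4 F)) := by gcongr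
        _ = (2 + 20 * ENNReal.ofReal thmTwoK) * eHkNormSq α 4 F := by ring
    have h2 := lintegral_sq_rep_le hF hS
    calc (∫⁻ p in strip, ENNReal.ofReal (Ψr p ^ 2)) ^ (1 / 2 : ℝ) * (2:ℝ≥0∞) ^ (1 / 2 : ℝ)
        ≤ (ENNReal.ofReal (1 / min (1 / 2) (2 * α)) * (eHkNormSq α 4 (Fhat F)) ^ (1 / 2 : ℝ)) * (2:ℝ≥0∞) ^ (1 / 2 : ℝ) :=
          mul_le_mul_left h2 _
      _ ≤ (ENNReal.ofReal (1 / min (1 / 2) (2 * α)) * ((2 + 20 * ENNReal.ofReal thmTwoK) * eHkNormSq α 4 F) ^ (1 / 2 : ℝ)) *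
            (2:ℝ≥0∞) ^ (1 / 2 : ℝ) := by gcongr
      _ = _ := by rw [ENNReal.mul_rpow_of_nonneg _ _ (by norm_num : (0:ℝ) ≤ 1 / 2)]; ring
  -- part 2: `G⋆ ⊗ sin 2θ`, bounded pointwise
  have b2 : ∫⁻ p in strip, f2 p ≤ ENNReal.ofReal (1 / (4 * α) * Real.sqrt 2) * (ENNReal.ofReal (9 * π / 32)) ^ (1 / 2 : ℝ) * 2 *
      (eHkNormSq α 4 F) ^ (1 / 2 : ℝ) := by
    set A : ℝ≥0∞ := ENNReal.ofReal (1 / (4 * α) * Real.sqrt 2) * (ENNReal.ofReal (9 * π / 32) * eHkNormSq α 4 F) ^ (1 / 2 : ℝ) with hA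
    have hpt2 : ∀ p : ℝ × ℝ, f2 p ≤ A * ENNReal.ofReal (rhoW p) := by
      intro p
      simp only [hf2]
      have hs1 : |Real.sin (2 * p.2)| ≤ 1 := Real.abs_sin_le_one _
      calc ENNReal.ofReal (|Gstar α F p.1 * Real.sin (2 * p.2)| * rhoW p)
          ≤ ENNReal.ofReal (|Gstar α F p.1| * rhoW p) := by
            refine ENNReal.ofReal_le_ofReal (mul_le_mul_of_nonneg_right ?_ (rhoW_pos p).le)
            rw [abs_mul]; exact mul_le_of_le_one_right (abs_nonneg _) hs1
        _ = ENNReal.ofReal |Gstar α F p.1| * ENNReal.ofReal (rhoW p) := ENNReal.ofReal_mul (abs_nonneg _)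
        _ ≤ A * ENNReal.ofReal (rhoW p) := mul_le_mul_left (abs_Gstar_le hF hα p.1) _
    calc ∫⁻ p in strip, f2 p ≤ ∫⁻ p in strip, A * ENNReal.ofReal (rhoW p) := lintegral_mono fun p => hpt2 p
      _ = A * ∫⁻ p in strip, ENNReal.ofReal (rhoW p) := lintegral_const_mul A measurable_rhoW.ennreal_ofReal
      _ ≤ A * 2 := by
          refine mul_le_mul_right ?_ _
          simpa only [pow_one] using lintegral_rhoW_pow_le 1 le_rfl
      _ = _ := by rw [hA, ENNReal.mul_rpow_of_nonneg _ _ (by norm_num : (0:ℝ) ≤ 1 / 2)]; ring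
  -- part 3: `Ḡ ⊗ sin 2θ`
  have b3 : ∫⁻ p in strip, f3 p ≤ (2 * (ENNReal.ofReal (1 / 324) * ENNReal.ofReal (9 * π / 32))) ^ (1 / 2 : ℝ) * 2 ^ (1 / 2 : ℝ) *
      (eHkNormSq α 4 F) ^ (1 / 2 : ℝ) := by
    have m3 : AEMeasurable (fun p : ℝ × ℝ => Gbar α F p.1 * Real.sin (2 * p.2)) (volume.restrict strip) := by
      have hc : ContinuousOn (fun p : ℝ × ℝ => Gbar α F p.1 * Real.sin (2 * p.2)) strip := by
        refine ContinuousOn.mul ?_ (by fun_prop)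
        exact (hF.contDiffOn_Gbar 0).continuousOn.comp continuous_fst.continuousOn fun p hp => hp.1
      exact hc.aemeasurable measurableSet_strip
    refine (lintegral_abs_mul_rhoW_le m3).trans ?_
    calc (∫⁻ p in strip, ENNReal.ofReal ((Gbar α F p.1 * Real.sin (2 * p.2)) ^ 2)) ^ (1 / 2 : ℝ) * (2:ℝ≥0∞) ^ (1 / 2 : ℝ)
        ≤ (2 * (ENNReal.ofReal (1 / 324) * (ENNReal.ofReal (9 * π / 32) * eHkNormSq α 4 F))) ^ (1 / 2 : ℝ) * (2:ℝ≥0∞) ^ (1 / 2 : ℝ) := by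
          gcongr; exact lintegral_sq_Gbar_le hF hα hα1
      _ = _ := by
          rw [show 2 * (ENNReal.ofReal (1 / 324) * (ENNReal.ofReal (9 * π / 32) * eHkNormSq α 4 F)) =
              (2 * (ENNReal.ofReal (1 / 324) * ENNReal.ofReal (9 * π / 32))) * eHkNormSq α 4 F by ring,
            ENNReal.mul_rpow_of_nonneg _ (eHkNormSq α 4 F) (by norm_num : (0:ℝ) ≤ 1 / 2)]
          ring
  have m12 : AEMeasurable (fun p => f1 p + f2 p) (volume.restrict strip) := m1.add m2
  calc ∫⁻ p in strip, ENNReal.ofReal (|thmTwoSol α F Ψr p.1 p.2| * rhoW p)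
      ≤ ∫⁻ p in strip, (f1 p + f2 p + f3 p) := lintegral_mono fun p => hpt p
    _ = (∫⁻ p in strip, f1 p) + (∫⁻ p in strip, f2 p) + ∫⁻ p in strip, f3 p := by
        rw [lintegral_add_left' m12, lintegral_add_left' m1]
    _ ≤ _ := add_le_add (add_le_add b1 b2) b3
    _ = cauchyC α * (eHkNormSq α 4 F) ^ (1 / 2 : ℝ) := by rw [cauchyC, add_mul, add_mul]

end parts

/-- **Weighted `L¹` continuity of `F ↦ Ψ_F`** on nice data: for solution data of `F̂₁`, `F̂₂`,
`∫∫_strip |Ψ_{F₁} − Ψ_{F₂}|·ρ ≤ cauchyC(α)·|F₁ − F₂|_{𝓗⁴}`. [cite: Elgindi2021, §7.5 Theorem 2 (p. 24 of arXiv:1904.04795)] -/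
theorem lintegral_thmTwoSol_sub_le {α : ℝ} {F₁ F₂ : ℝ → ℝ → ℝ} (h₁ : NiceDatum F₁) (h₂ : NiceDatum F₂)
    {U₁ U₂ : ℕ → E4} {Ψ₁ Ψ₂ : ℝ × ℝ → ℝ} (hS₁ : SolData α (Fhat F₁) U₁ Ψ₁) (hS₂ : SolData α (Fhat F₂) U₂ Ψ₂) :
    ∫⁻ p in strip, ENNReal.ofReal (|thmTwoSol α F₁ Ψ₁ p.1 p.2 - thmTwoSol α F₂ Ψ₂ p.1 p.2| * rhoW p) ≤
      cauchyC α * (eHkNormSq α 4 (F₁ - F₂)) ^ (1 / 2 : ℝ) := by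
  have hα := hS₁.pos
  have hα5 : α ≤ 5 := hS₁.le4.trans (by norm_num)
  have hSD : SolData α (Fhat (F₁ - F₂)) (U₁ - U₂) (Ψ₁ - Ψ₂) := by rw [h₁.Fhat_sub h₂]; exact hS₁.sub hS₂
  have h := lintegral_thmTwoSol_rho_le (h₁.diff h₂) hSD
  rw [thmTwoSol_sub hα hα5 h₁ h₂] at h
  exact h

end Elgindi

end Literature.Analysis.FluidPDE
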